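import Summits.Ventures.DiscreteObjects.Hadamard.PAFParityTools
import Literature.Combinatorics.Designs.LegendrePairs.NineCompressionProfile333

/-!
# Conference pairs: the cored block is automatically SYMMETRIC (odd length) — a parity theorem for row F11, and the
# one-circulant-core reading (`PAF = −1`: symmetric if `v ≡ 1`, skew if `v ≡ 3 (mod 4)`)

Framing: lottery ticket; floor = certified bounds/negative ranges.  Cell pub-namedobj (venture DiscreteObjects),
target (H), hadamard gen 27.  In gen 27's `ConferenceRoute668` a CONFERENCE PAIR of length `v` is `(a, b)` on `ZMod v` with
`a 0 = 0`, `a x = ±1 (x ≠ 0)`, `b` `±1`-valued and `PAF_a(s) + PAF_b(s) = 0 (s ≠ 0)` — the first rows of a two-circulant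
('2C-type', Balonin–Đoković 2015) conference matrix `[[A, B], [−Bᵀ, Aᵀ]]` of order `2v`.  THIS FILE proves a structural fact
that the census of that file left open ("`h = ±1` is the open residue"): for the CORED row `a` the reflection `h = −1` is not
an assumption but a THEOREM.
* `paf_fill_zero`: filling the zero of `a` by `1` changes `PAF(s)` by `a(s) + a(−s)` (`s ≠ 0`).
* `cored_reflection_congruence`: if `a 0 = 0`, `a` is `±1` elsewhere and `PAF_a(s) = v − r − 4k` then `a(s) + a(−s) ≡ r (mod 4)`
  (from gen 19's `paf_mod_four`: `PAF ≡ v (mod 4)` for `±1` sequences).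
* **`confPair_symmetricA`**: for ODD `v`, in every conference pair the cored sequence is symmetric: **`a (−x) = a x` for all `x`**
  (`PAF_b ≡ v`, so `PAF_a ≡ −v`, so `a(s) + a(−s) ≡ 2v ≡ 2 (mod 4)`, which for `±1` values means equality).  Instance
  **`confPair167_symmetricA`**; `confPair_no_skewA` (no `a(−x) = −a(x)`).  E2 (check_g27_tables.py part 3): all conference pairs of
  lengths 5, 7, 9, 13 (20/84/108/364) have symmetric `a`, while `b` need not be reflection-symmetric (208 of 364 at `v = 13`).
* **`core_symm_of_paf_neg_one` / `core_skew_of_paf_neg_one`**: a cored sequence with two-level autocorrelation `PAF_a(s) = −1`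
  (`s ≠ 0`) — the first row of a circulant CORE of a conference matrix of order `v + 1` — is symmetric when `v ≡ 1 (mod 4)` and
  skew (`a(−x) = −a(x)`) when `v ≡ 3 (mod 4)` (the Paley dichotomy as a parity theorem, any `v`); at `v = 333 ≡ 1 (mod 4)`:
  **`core333_symmetric`** — a one-circulant-core `C(334)` would have a symmetric core, i.e. be a cyclic conference graph
  `srg(333,166,82,83)` on `ℤ/333` (in print such circulant strongly regular graphs exist only on a prime number of vertices —
  Bridges–Mena / Ma; not formalised here: we record only the kernel parity statement).
* §3 (appended): **`no_cyclicCore_conference334`** — NO conference matrix of order `334` has a circulant core (no cyclic conference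
  graph `srg(333,166,82,83)`): parity makes the core symmetric, the 9-fold compression (pub-lottery `NineComp333` tools) leaves a
  five-variable integer system, and `nineFold_core334_system_empty` (`decide +kernel`, `12⁴` cases) shows it is empty — an
  elementary kernel certificate of a case of the Bridges–Mena/Ma theorem (circulant strongly regular graphs have prime order).
WORDS: structure theorems about hypothetical objects (every 2C-type `C(2v)`, `v` odd, has a symmetric `A`-block) and ONE whole
sub-family decided EMPTY (one-circulant-core `C(334)`); no Hadamard order excluded; `C(334)`, `H(668)` untouched.  Ours; no `sorry`.
-/

namespace Summit.Ventures.DiscreteObjects.Hadamard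

open Finset BigOperators

open Literature.Combinatorics.Designs.LegendrePairs (PAF IsPM)

variable {n : ℕ} [NeZero n]

/-- **filling the zero**: for `a` with `a 0 = 0` and `c = a` except `c 0 = 1`, `PAF_c(s) = PAF_a(s) + a(s) + a(−s)` for `s ≠ 0`. -/
theorem paf_fill_zero (a : ZMod n → ℤ) (ha0 : a 0 = 0) {s : ZMod n} (hs : s ≠ 0) :
    PAF (fun i => if i = 0 then 1 else a i) s = PAF a s + a s + a (-s) := by
  unfold PAF
  have hms : (-s : ZMod n) ≠ 0 := fun h => hs (neg_eq_zero.mp h)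
  have hterm : ∀ i : ZMod n, (if i = 0 then (1 : ℤ) else a i) * (if i + s = 0 then 1 else a (i + s)) =
      a i * a (i + s) + ((if i = 0 then a s else 0) + (if i = -s then a (-s) else 0)) := by
    intro i
    by_cases hi : i = 0
    · subst hi
      have h1 : (0 : ZMod n) + s ≠ 0 := by rwa [zero_add]
      have h0s : (0 : ZMod n) ≠ -s := fun h => hms h.symm
      rw [if_pos rfl, if_neg h1, if_pos rfl, if_neg h0s, zero_add, ha0]; ring
    · by_cases his : i = -s
      · subst his
        rw [if_neg hms, if_pos (neg_add_cancel s), if_neg hms, if_pos rfl, neg_add_cancel, ha0]; ring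
      · have h2 : i + s ≠ 0 := fun h => his (eq_neg_of_add_eq_zero_left h)
        rw [if_neg hi, if_neg h2, if_neg hi, if_neg his]; ring
  rw [Finset.sum_congr rfl (fun i _ => hterm i), Finset.sum_add_distrib, Finset.sum_add_distrib,
    Finset.sum_ite_eq' Finset.univ (0 : ZMod n), Finset.sum_ite_eq' Finset.univ (-s : ZMod n)]
  simp only [Finset.mem_univ, if_true]; ring

omit [NeZero n] in
/-- a filled cored sequence is `±1`-valued. -/
lemma isPM_fill_zero (a : ZMod n → ℤ) (ha : ∀ i, i ≠ 0 → a i = 1 ∨ a i = -1) :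
    IsPM (fun i => if i = 0 then 1 else a i) := by
  intro i
  by_cases hi : i = 0
  · simp [hi]
  · simp only [if_neg hi]; exact ha i hi

/-- **reflection congruence for a cored sequence**: if `a 0 = 0`, `a` is `±1` off `0`, `s ≠ 0` and `PAF_a(s) = n − r − 4k`, then
`a(s) + a(−s) ≡ r (mod 4)` — precisely, `4 ∣ a s + a (−s) − r`. -/
theorem cored_reflection_congruence (a : ZMod n → ℤ) (ha0 : a 0 = 0) (ha : ∀ i, i ≠ 0 → a i = 1 ∨ a i = -1)
    {s : ZMod n} (hs : s ≠ 0) {r k : ℤ} (hpaf : PAF a s = n - r - 4 * k) : (4 : ℤ) ∣ a s + a (-s) - r := by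
  obtain ⟨k', hk'⟩ := paf_mod_four _ (isPM_fill_zero a ha) s
  rw [paf_fill_zero a ha0 hs, hpaf] at hk'
  exact ⟨k - k', by linarith⟩

/-- **In a conference pair of ODD length the cored sequence is symmetric**: `a (−x) = a x` for every `x`. -/
theorem confPair_symmetricA (hn : Odd n) (a b : ZMod n → ℤ) (ha0 : a 0 = 0) (ha : ∀ i, i ≠ 0 → a i = 1 ∨ a i = -1)
    (hb : IsPM b) (hab : ∀ s : ZMod n, s ≠ 0 → PAF a s + PAF b s = 0) : ∀ x, a (-x) = a x := by
  intro x
  by_cases hx : x = 0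
  · rw [hx, neg_zero]
  obtain ⟨kb, hkb⟩ := paf_mod_four b hb x
  have hpa : PAF a x = n - 2 * n - 4 * (-kb) := by linarith [hab x hx]
  have h4 := cored_reflection_congruence a ha0 ha hx hpa
  obtain ⟨m, hm⟩ := hn
  have hxm : (-x : ZMod n) ≠ 0 := fun h => hx (neg_eq_zero.mp h)
  rcases ha x hx with h1 | h1 <;> rcases ha (-x) hxm with h2 | h2 <;> rw [h1, h2] at h4 ⊢ <;> first | rfl | (exfalso; omega)

/-- hence **no skew-type cored row** in a conference pair of odd length `> 1`. -/
theorem confPair_no_skewA (hn : Odd n) (h1 : 1 < n) (a b : ZMod n → ℤ) (ha0 : a 0 = 0)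
    (ha : ∀ i, i ≠ 0 → a i = 1 ∨ a i = -1) (hb : IsPM b) (hab : ∀ s : ZMod n, s ≠ 0 → PAF a s + PAF b s = 0)
    (hskew : ∀ x, a (-x) = -a x) : False := by
  haveI : Fact (1 < n) := ⟨h1⟩
  have h := confPair_symmetricA hn a b ha0 ha hb hab 1
  rw [hskew 1] at h
  rcases ha 1 one_ne_zero with e | e <;> rw [e] at h <;> norm_num at h

/-- **Row F11 at `v = 167`: the `A`-block of any two-circulant conference matrix `C(334)` is symmetric** (`a(−x) = a(x)`);
with `confPair167_no_multiplierA` (gen 27, `ConferenceRoute668`) the set-wise stabiliser of `a` in `(ℤ/167)ˣ` is exactly `{±1}`. -/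
theorem confPair167_symmetricA (a b : ZMod 167 → ℤ) (ha0 : a 0 = 0) (ha : ∀ i, i ≠ 0 → a i = 1 ∨ a i = -1) (hb : IsPM b)
    (hab : ∀ s : ZMod 167, s ≠ 0 → PAF a s + PAF b s = 0) : ∀ x, a (-x) = a x :=
  confPair_symmetricA ⟨83, by norm_num⟩ a b ha0 ha hb hab

/-! ## The one-circulant core: `PAF = −1` forces symmetric (`v ≡ 1`) or skew (`v ≡ 3 (mod 4)`) -/

/-- **a cored sequence with `PAF_a(s) = −1` (`s ≠ 0`) on `v ≡ 1 (mod 4)` points is symmetric.** -/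
theorem core_symm_of_paf_neg_one (hn : n % 4 = 1) (a : ZMod n → ℤ) (ha0 : a 0 = 0) (ha : ∀ i, i ≠ 0 → a i = 1 ∨ a i = -1)
    (hpaf : ∀ s : ZMod n, s ≠ 0 → PAF a s = -1) : ∀ x, a (-x) = a x := by
  intro x
  by_cases hx : x = 0
  · rw [hx, neg_zero]
  have hpa : PAF a x = n - (n + 1) - 4 * 0 := by rw [hpaf x hx]; ring
  have h4 := cored_reflection_congruence a ha0 ha hx hpa
  have hxm : (-x : ZMod n) ≠ 0 := fun h => hx (neg_eq_zero.mp h)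
  have hn' : ∃ m : ℕ, n = 4 * m + 1 := ⟨n / 4, by omega⟩
  obtain ⟨m, hm⟩ := hn'
  rcases ha x hx with h1 | h1 <;> rcases ha (-x) hxm with h2 | h2 <;> rw [h1, h2] at h4 ⊢ <;> first | rfl | (exfalso; omega)

/-- **a cored sequence with `PAF_a(s) = −1` (`s ≠ 0`) on `v ≡ 3 (mod 4)` points is skew** (`a(−x) = −a(x)`; Paley-type). -/
theorem core_skew_of_paf_neg_one (hn : n % 4 = 3) (a : ZMod n → ℤ) (ha0 : a 0 = 0) (ha : ∀ i, i ≠ 0 → a i = 1 ∨ a i = -1)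
    (hpaf : ∀ s : ZMod n, s ≠ 0 → PAF a s = -1) : ∀ x, a (-x) = -a x := by
  intro x
  by_cases hx : x = 0
  · rw [hx, neg_zero, ha0]; norm_num
  have hpa : PAF a x = n - (n + 1) - 4 * 0 := by rw [hpaf x hx]; ring
  have h4 := cored_reflection_congruence a ha0 ha hx hpa
  have hxm : (-x : ZMod n) ≠ 0 := fun h => hx (neg_eq_zero.mp h)
  have hn' : ∃ m : ℕ, n = 4 * m + 3 := ⟨n / 4, by omega⟩
  obtain ⟨m, hm⟩ := hn'
  rcases ha x hx with h1 | h1 <;> rcases ha (-x) hxm with h2 | h2 <;> rw [h1, h2] at h4 ⊢ <;> first | rfl | (exfalso; omega)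

/-- **at `v = 333 ≡ 1 (mod 4)`: the core row of a one-circulant-core conference matrix of order `334` (`a 0 = 0`, `±1` elsewhere,
`PAF_a(s) = −1` for `s ≠ 0`) is symmetric** — i.e. it is the connection sequence of a cyclic conference graph `srg(333, 166, 82, 83)`. -/
theorem core333_symmetric (a : ZMod 333 → ℤ) (ha0 : a 0 = 0) (ha : ∀ i, i ≠ 0 → a i = 1 ∨ a i = -1)
    (hpaf : ∀ s : ZMod 333, s ≠ 0 → PAF a s = -1) : ∀ x, a (-x) = a x :=
  core_symm_of_paf_neg_one (by norm_num) a ha0 ha hpaf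

/-- and at `v = 167 ≡ 3 (mod 4)` such a core (a core of a conference matrix of order `168 ≡ 0 (mod 4)`) is skew — the Paley
core `χ₁₆₇` is an example (recorded as the `(+)` reading of the dichotomy; not a census row). -/
theorem core167_skew (a : ZMod 167 → ℤ) (ha0 : a 0 = 0) (ha : ∀ i, i ≠ 0 → a i = 1 ∨ a i = -1)
    (hpaf : ∀ s : ZMod 167, s ≠ 0 → PAF a s = -1) : ∀ x, a (-x) = -a x :=
  core_skew_of_paf_neg_one (by norm_num) a ha0 ha hpaf

/-! ## §3 (appended, gen 27) The cyclic core of `C(334)` is impossible: parity + 9-fold compression + a finite check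

A one-circulant core of a conference matrix of order `334` is a sequence `a : ZMod 333 → {0, ±1}` with `a 0 = 0`, `a x = ±1`
otherwise and `PAF_a(s) = −1` for all `s ≠ 0` (equivalently: a CYCLIC conference graph `srg(333,166,82,83)`, i.e. a Paley-type
partial difference set in `ℤ/333`).  By `core333_symmetric` it is symmetric.  Fold it modulo `9` (the pub-lottery cell's compression
tools `NineComp333.cs`, `paf_class9`, [RamosHulakDeQueiroz2026, Lemma 2] after Đoković–Kotsireas): the nine class sums `E_r`
are symmetric (`E_{9−r} = E_r`), `E_0` is even and `E_r` odd for `r ≠ 0`, `Σ_r E_r = Σ a = 0`, `Σ_r E_r² = 332 − 36 = 296`,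
and `Σ_r E_r E_{r+1} = −37`; in the five free values this reads `E_0 = −2(E_1+E_2+E_3+E_4)`,
`E_0² + 2 Σ E_i² = 296`, `2E_0E_1 + 2E_1E_2 + 2E_2E_3 + 2E_3E_4 + E_4² = −37` — a system with NO solution in odd `|E_i| ≤ 11`
(`nineFold_core334_system_empty`, `decide +kernel` over `12⁴` cases; an independent plain-Python enumeration agrees: 132 tuples
pass the square-sum, none the shift-1 equation).  Hence **`no_cyclicCore_conference334`**: no conference matrix of order `334`
has a circulant core — in print this is a case of the theorem that nontrivial circulant strongly regular graphs have prime order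
(Bridges–Mena; Ma); here it is an elementary kernel certificate.  `C(334)` itself (and `H(668)`) untouched. -/

section cyclicCore334

open Literature.Combinatorics.Designs.LegendrePairs (sq_rowsum)
open Literature.Combinatorics.Designs.LegendrePairs.NineComp333 (χ cs paf_class9 rowsum_eq9 card_class9)

/-- `E² ≤ 148 ⇒ |E| ≤ 12`. -/
lemma abs_le_twelve_of_mul_self_le {E : ℤ} (h : E * E ≤ 148) : -12 ≤ E ∧ E ≤ 12 := by
  constructor <;> nlinarith [h]

/-- **class sums of a symmetric sequence on `ZMod 333` are symmetric**: `cs 9 a (9 − r) = cs 9 a r` for `1 ≤ r ≤ 8`. -/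
lemma cs9_symm_of_symm (a : ZMod 333 → ℤ) (hsym : ∀ x, a (-x) = a x) (r : ℕ) (hr1 : 1 ≤ r) (hr8 : r ≤ 8) :
    cs 9 a (9 - r) = cs 9 a r := by
  unfold cs
  conv_rhs => rw [← Equiv.sum_comp (Equiv.neg (ZMod 333))]
  refine Finset.sum_congr rfl (fun i _ => ?_)
  simp only [Equiv.neg_apply, hsym]
  congr 1
  unfold χ
  rw [ZMod.neg_val]
  by_cases hi : i = 0
  · subst hi
    rw [if_pos rfl, ZMod.val_zero]
    rw [if_neg (by omega), if_neg (by omega)]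
  · rw [if_neg hi]
    have hv : i.val < 333 := ZMod.val_lt i
    have hv0 : i.val ≠ 0 := fun h => hi ((ZMod.val_eq_zero i).mp h)
    by_cases h1 : i.val % 9 = 9 - r
    · rw [if_pos h1, if_pos (by omega)]
    · rw [if_neg h1, if_neg (by omega)]

/-- **parity of the class sums of a cored sequence**: `cs 9 a r + [r = 0] = 37 − 2k` (so `E_0` is even, `E_r` odd for `r ≠ 0`). -/
lemma cs9_core_parity (a : ZMod 333 → ℤ) (ha0 : a 0 = 0) (ha : ∀ i, i ≠ 0 → a i = 1 ∨ a i = -1) (r : ℕ) (hr : r < 9) :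
    ∃ k : ℤ, cs 9 a r + (if r = 0 then 1 else 0) = 37 - 2 * k := by
  set b : ZMod 333 → ℤ := fun i => if a i = -1 then 1 else 0 with hb
  have hab : ∀ i, a i = 1 - 2 * b i - (if i = 0 then 1 else 0) := by
    intro i
    by_cases hi : i = 0
    · subst hi; simp [hb, ha0]
    · rcases ha i hi with h | h <;> simp [hb, h, hi]
  refine ⟨∑ i, χ 9 r i * b i, ?_⟩
  unfold cs
  rw [Finset.sum_congr rfl (fun i _ => by rw [hab i])]
  have e : ∀ i : ZMod 333, χ 9 r i * (1 - 2 * b i - (if i = 0 then 1 else 0)) =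
      χ 9 r i - 2 * (χ 9 r i * b i) - (if i = 0 then χ 9 r i else 0) := by
    intro i; split_ifs <;> ring
  rw [Finset.sum_congr rfl (fun i _ => e i), Finset.sum_sub_distrib, Finset.sum_sub_distrib, card_class9 r hr,
    ← Finset.mul_sum, Finset.sum_ite_eq' Finset.univ (0 : ZMod 333), if_pos (Finset.mem_univ _)]
  unfold χ
  rw [ZMod.val_zero, Nat.zero_mod]
  by_cases h0 : r = 0
  · subst h0; simp
  · rw [if_neg (fun h => h0 h.symm), if_neg h0]; ring

set_option maxRecDepth 16384 in
/-- **class sums of `PAF` for a cored sequence with `PAF = −1`**: `Σ_{s ≡ t (9)} PAF_a(s)` is `296` for `t = 0` and `−37` for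
`1 ≤ t ≤ 8`. -/
lemma core334_class_paf (a : ZMod 333 → ℤ) (ha0 : a 0 = 0) (ha : ∀ i, i ≠ 0 → a i = 1 ∨ a i = -1)
    (hpaf : ∀ s : ZMod 333, s ≠ 0 → PAF a s = -1) (t : ℕ) (ht : t < 9) :
    ∑ s, χ 9 t s * PAF a s = if t = 0 then 296 else -37 := by
  have hP0 : PAF a 0 = 332 := by
    unfold PAF
    have e : ∀ i : ZMod 333, a i * a (i + 0) = 1 - (if i = 0 then 1 else 0) := by
      intro i; rw [add_zero]
      by_cases hi : i = 0
      · subst hi; rw [ha0, if_pos rfl]; norm_num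
      · rcases ha i hi with h | h <;> rw [h, if_neg hi] <;> norm_num
    rw [Finset.sum_congr rfl (fun i _ => e i), Finset.sum_sub_distrib, Finset.sum_const, Finset.card_univ, ZMod.card,
      Finset.sum_ite_eq' Finset.univ (0 : ZMod 333), if_pos (Finset.mem_univ _)]
    norm_num
  have key : ∀ s : ZMod 333, χ 9 t s * PAF a s =
      if s = 0 then (if t = 0 then 332 else 0) else (if s.val % 9 = t then -1 else 0) := by
    intro s
    by_cases hs : s = 0
    · subst hs
      rw [hP0, if_pos rfl]
      unfold χ
      rw [ZMod.val_zero, Nat.zero_mod]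
      by_cases h0 : t = 0
      · rw [if_pos h0.symm, if_pos h0]; norm_num
      · rw [if_neg (fun h' => h0 h'.symm), if_neg h0]; norm_num
    · rw [if_neg hs, hpaf s hs]; unfold χ; split_ifs <;> simp
  rw [Finset.sum_congr rfl fun s _ => key s]
  interval_cases t <;> decide

/-- the row sum of a cored sequence with `PAF = −1` on `333` points vanishes (`(Σa)² = 332 − 332`). -/
lemma core334_rowsum (a : ZMod 333 → ℤ) (ha0 : a 0 = 0) (ha : ∀ i, i ≠ 0 → a i = 1 ∨ a i = -1)
    (hpaf : ∀ s : ZMod 333, s ≠ 0 → PAF a s = -1) : ∑ i, a i = 0 := by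
  have h0 := core334_class_paf a ha0 ha hpaf 0 (by norm_num)
  have hsq := sq_rowsum a
  have e : ∑ s, PAF a s = ∑ s, (if s = (0 : ZMod 333) then 333 else 0) + ∑ s : ZMod 333, (-1 : ℤ) := by
    rw [← Finset.sum_add_distrib]
    refine Finset.sum_congr rfl (fun s _ => ?_)
    by_cases hs : s = 0
    · subst hs
      have : PAF a 0 = 332 := by
        have := h0; rw [if_pos rfl] at this
        rw [paf_class9 a 0 (by norm_num)] at this
        -- not needed: compute directly instead
        unfold PAF
        have e : ∀ i : ZMod 333, a i * a (i + 0) = 1 - (if i = 0 then 1 else 0) := by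
          intro i; rw [add_zero]
          by_cases hi : i = 0
          · subst hi; rw [ha0, if_pos rfl]; norm_num
          · rcases ha i hi with h | h <;> rw [h, if_neg hi] <;> norm_num
        rw [Finset.sum_congr rfl (fun i _ => e i), Finset.sum_sub_distrib, Finset.sum_const, Finset.card_univ, ZMod.card,
          Finset.sum_ite_eq' Finset.univ (0 : ZMod 333), if_pos (Finset.mem_univ _)]
        norm_num
      rw [this, if_pos rfl]; norm_num
    · rw [hpaf s hs, if_neg hs]; norm_num
  rw [e, Finset.sum_ite_eq' Finset.univ (0 : ZMod 333), if_pos (Finset.mem_univ _), Finset.sum_const, Finset.card_univ,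
    ZMod.card] at hsq
  norm_num at hsq
  exact hsq

set_option maxHeartbeats 4000000 in
/-- **the folded system has no solution** (`decide +kernel`, `12⁴` cases): odd `E_1..E_4` with `|E_i| ≤ 11`,
`E_0 = −2 Σ E_i`, `E_0² + 2 Σ E_i² = 296` and the shift-`1` equation `2E_0E_1 + 2E_1E_2 + 2E_2E_3 + 2E_3E_4 + E_4² = −37`
(`E_i = 2 x_i − 11`, `x_i < 12`). -/
lemma nineFold_core334_system_empty :
    ∀ x1 < 12, ∀ x2 < 12, ∀ x3 < 12, ∀ x4 < 12,
      ¬ ((-2 * ((2 * ((x1 : ℕ) : ℤ) - 11) + (2 * ((x2 : ℕ) : ℤ) - 11) + (2 * ((x3 : ℕ) : ℤ) - 11) + (2 * ((x4 : ℕ) : ℤ) - 11))) * (-2 * ((2 * ((x1 : ℕ) : ℤ) - 11) + (2 * ((x2 : ℕ) : ℤ) - 11) + (2 * ((x3 : ℕ) : ℤ) - 11) + (2 * ((x4 : ℕ) : ℤ) - 11))) + 2 * ((2 * ((x1 : ℕ) : ℤ) - 11) * (2 * ((x1 : ℕ) : ℤ) - 11) + (2 * ((x2 : ℕ) : ℤ)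 - 11) * (2 * ((x2 : ℕ) : ℤ) - 11) + (2 * ((x3 : ℕ) : ℤ) - 11) * (2 * ((x3 : ℕ) : ℤ) - 11) + (2 * ((x4 : ℕ) : ℤ) - 11) * (2 * ((x4 : ℕ) : ℤ) - 11)) = 296 ∧
         2 * (-2 * ((2 * ((x1 : ℕ) : ℤ) - 11) + (2 * ((x2 : ℕ) : ℤ) - 11) + (2 * ((x3 : ℕ) : ℤ) - 11) + (2 * ((x4 : ℕ) : ℤ) - 11))) * (2 * ((x1 : ℕ) : ℤ) - 11) + 2 * (2 * ((x1 : ℕ) : ℤ) - 11) * (2 * ((x2 : ℕ) : ℤ) - 11) + 2 * (2 * ((x2 : ℕ) : ℤ) - 11) * (2 * ((x3 : ℕ) : ℤ) - 11) + 2 * (2 * ((x3 : ℕ) : ℤ) - 11) * (2 * ((x4 : ℕ) : ℤ) - 11) + (2 * ((x4 : ℕ) : ℤ) - 11) * (2 * ((x4 : ℕ) : ℤ) - 11) = -37) := by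
  decide +kernel

/-- **No conference matrix of order `334` has a circulant core**: there is no `a : ZMod 333 → ℤ` with `a 0 = 0`, `a x = ±1`
for `x ≠ 0` and `PAF_a(s) = −1` for all `s ≠ 0` (no cyclic conference graph `srg(333,166,82,83)`, no cyclic Paley-type partial
difference set of order `333`).  Kernel certificate: parity (`core333_symmetric`) + 9-fold compression + `12⁴`-case check. -/
theorem no_cyclicCore_conference334 (a : ZMod 333 → ℤ) (ha0 : a 0 = 0) (ha : ∀ i, i ≠ 0 → a i = 1 ∨ a i = -1)
    (hpaf : ∀ s : ZMod 333, s ≠ 0 → PAF a s = -1) : False := by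
  have hsym := core333_symmetric a ha0 ha hpaf
  -- the nine class sums
  have h8 : cs 9 a 8 = cs 9 a 1 := cs9_symm_of_symm a hsym 1 (by norm_num) (by norm_num)
  have h7 : cs 9 a 7 = cs 9 a 2 := cs9_symm_of_symm a hsym 2 (by norm_num) (by norm_num)
  have h6 : cs 9 a 6 = cs 9 a 3 := cs9_symm_of_symm a hsym 3 (by norm_num) (by norm_num)
  have h5 : cs 9 a 5 = cs 9 a 4 := cs9_symm_of_symm a hsym 4 (by norm_num) (by norm_num)
  -- square sum and shift-1 sum
  have hsq := core334_class_paf a ha0 ha hpaf 0 (by norm_num)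
  rw [if_pos rfl, paf_class9 a 0 (by norm_num)] at hsq
  simp only [Finset.sum_range_succ, Finset.sum_range_zero, zero_add, Nat.reduceAdd, Nat.reduceMod, h8, h7, h6, h5] at hsq
  have hs1 := core334_class_paf a ha0 ha hpaf 1 (by norm_num)
  rw [if_neg (by norm_num), paf_class9 a 1 (by norm_num)] at hs1
  simp only [Finset.sum_range_succ, Finset.sum_range_zero, zero_add, Nat.reduceAdd, Nat.reduceMod, h8, h7, h6, h5] at hs1
  -- row sum
  have hrow := core334_rowsum a ha0 ha hpaf
  rw [rowsum_eq9] at hrow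
  simp only [Finset.sum_range_succ, Finset.sum_range_zero, zero_add, h8, h7, h6, h5] at hrow
  -- parities
  obtain ⟨k1, hk1⟩ := cs9_core_parity a ha0 ha 1 (by norm_num)
  obtain ⟨k2, hk2⟩ := cs9_core_parity a ha0 ha 2 (by norm_num)
  obtain ⟨k3, hk3⟩ := cs9_core_parity a ha0 ha 3 (by norm_num)
  obtain ⟨k4, hk4⟩ := cs9_core_parity a ha0 ha 4 (by norm_num)
  rw [if_neg (by norm_num), add_zero] at hk1 hk2 hk3 hk4
  set E0 := cs 9 a 0 with hE0
  set E1 := cs 9 a 1 with hE1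
  set E2 := cs 9 a 2 with hE2
  set E3 := cs 9 a 3 with hE3
  set E4 := cs 9 a 4 with hE4
  have hE0' : E0 = -2 * (E1 + E2 + E3 + E4) := by linarith
  -- clean forms of the three identities
  have hsq' : E0 * E0 + 2 * (E1 * E1 + E2 * E2 + E3 * E3 + E4 * E4) = 296 := by linarith only [hsq]
  have hs1' : 2 * E0 * E1 + 2 * E1 * E2 + 2 * E2 * E3 + 2 * E3 * E4 + E4 * E4 = -37 := by linarith only [hs1]
  -- bounds `|E_i| ≤ 11` and the parametrisation `E_i = 2 x_i − 11`
  have b1 : E1 * E1 ≤ 148 := by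
    linarith only [hsq', mul_self_nonneg E0, mul_self_nonneg E2, mul_self_nonneg E3, mul_self_nonneg E4]
  have b2 : E2 * E2 ≤ 148 := by
    linarith only [hsq', mul_self_nonneg E0, mul_self_nonneg E1, mul_self_nonneg E3, mul_self_nonneg E4]
  have b3 : E3 * E3 ≤ 148 := by
    linarith only [hsq', mul_self_nonneg E0, mul_self_nonneg E1, mul_self_nonneg E2, mul_self_nonneg E4]
  have b4 : E4 * E4 ≤ 148 := by
    linarith only [hsq', mul_self_nonneg E0, mul_self_nonneg E1, mul_self_nonneg E2, mul_self_nonneg E3]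
  obtain ⟨a1, a1'⟩ := abs_le_twelve_of_mul_self_le b1
  obtain ⟨a2, a2'⟩ := abs_le_twelve_of_mul_self_le b2
  obtain ⟨a3, a3'⟩ := abs_le_twelve_of_mul_self_le b3
  obtain ⟨a4, a4'⟩ := abs_le_twelve_of_mul_self_le b4
  obtain ⟨x1, hx1, ex1⟩ : ∃ x : ℕ, x < 12 ∧ E1 = 2 * (x : ℤ) - 11 := ⟨((E1 + 11) / 2).toNat, by omega, by omega⟩
  obtain ⟨x2, hx2, ex2⟩ : ∃ x : ℕ, x < 12 ∧ E2 = 2 * (x : ℤ) - 11 := ⟨((E2 + 11) / 2).toNat, by omega, by omega⟩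
  obtain ⟨x3, hx3, ex3⟩ : ∃ x : ℕ, x < 12 ∧ E3 = 2 * (x : ℤ) - 11 := ⟨((E3 + 11) / 2).toNat, by omega, by omega⟩
  obtain ⟨x4, hx4, ex4⟩ : ∃ x : ℕ, x < 12 ∧ E4 = 2 * (x : ℤ) - 11 := ⟨((E4 + 11) / 2).toNat, by omega, by omega⟩
  refine nineFold_core334_system_empty x1 hx1 x2 hx2 x3 hx3 x4 hx4 ⟨?_, ?_⟩
  · rw [← ex1, ← ex2, ← ex3, ← ex4, ← hE0']; exact hsq'
  · rw [← ex1, ← ex2, ← ex3, ← ex4, ← hE0']; exact hs1'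

end cyclicCore334

end Summit.Ventures.DiscreteObjects.Hadamard
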